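/-
Copyright: statement-level skeleton of a published paper (lit-balaban cell, Phase-2 proof seat p18 gen 8). No proof claims
beyond what the kernel checks below.
-/
import Literature.MathematicalPhysics.QuantumFieldTheory.Balaban1983to89.B3Resummation315

/-!
# B3 — T. Bałaban, *(Higgs)₂,₃ quantum fields in a finite volume. III. Renormalization*, CMP **88** (1983) 411–445
[Balaban1983Higgs3], pp. 438–439 [PDF 28–29]: the two-scalar-leg graphs WITH ONE LEG DIFFERENTIATED **(3.21)** and the
transformation **(3.22)** of the second one *"in a way similar to (3.17) and (3.20)"* — the two pictures of (3.21) TYPED as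
expressions (defs with bodies) on the torus calculus of record, **(3.22) PROVED** as the identity it is, and the chain (3.22) → (3.23)
(*"the second is treated in the same way as the expression (3.15): we sum over proper orderings and j-indices and we get (3.23)"*)
PROVED.  File 1 of 2; the estimate *"The first graph on the right side has positive degree"* and the zero-field torus instance are
the companion `B3Eq322PositiveDegree` (same seat).

statement-level skeleton of published theorems with citation tags; proofs where landed; nothing here is a claim about
the Yang–Mills mass gap

PDF held: `paper:balaban1983-higgs-2-3-quantum-fields-finite-volume` (journal page = PDF page + 410); pp. 435–439 [PDF 25–29] read
in the OCR text (`p0025.txt`–`p0029.txt`) and, for the pictures (3.21)/(3.22), on the ×4 renders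
`run/shared/lean/pub/pub-balaban/b2b-balaban-ref1/pages/1983-cmp88-higgs23-III/1983-cmp88-higgs23-III-p028-x4.png`, `…-p029-x4.png`.

CITATION HEADER (lean-in-tree rule).  Part of the lit-balaban TYPED SKELETON (HOME `run/shared/lean/pub/lit-balaban/`), PHASE 2,
seat p18 generation 8 (free-target protocol G.5-34(d); the item *"the (3.22) split for the second graph of (3.21) — its pre-Taylor
expression is printed ONLY as a picture"* of p20 gen 6's hand-off list).  WHAT IS REPRODUCED: row **B3.Eq3.21-3.24** of
`HOME/lit-balaban-r15/ROWS-B3.md` (fold owner r15, referee ref-4), sub-displays (3.21) and (3.22), whose cell records *"(3.21)–(3.22)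
pictures not typed"*.  CONSUMES BY NAME, nothing re-proved: r15's `B3Sect3ScalarSelfEnergy` (`Kernel`, `d1Kernel` = the kernel
`(∂^η_μG)(x,x′)`, `bracket323`/`expr323` = (3.23) p. 439, p245397), p20 g4's `B3Resummation315.d1Kernel_finset_sum`/`expr323_sum_sum`/
`expr323_resum` (multilinearity = the summation over orderings and indices, p253083), r15's `B3.Display26` ((2.6), p239134).  The graphs
as combinatorial objects are p18 g3's `B3Sect3LowestOrderGraphs.g321a/g321b` (p248264; not re-declared here).

THE PRINTED TEXT (verbatim, pp. 438–439).  *"We have to consider another class of graphs with two external scalar field legs, the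
graphs with one leg differentiated. There are only two such graphs: [picture a: one vertex, two scalar legs one of which carries the
derivative, a vector-field loop] , [picture b: two vertices x, x′ joined by a scalar line and a vector line, external scalar legs at x
and at x′, the one at x′ differentiated] (3.21) The expression corresponding to the first graph is in fact convergent, because ηG_k(x,x)
is convergent to some finite constant as η → 0. The second expression is transformed in a way similar to (3.17) and (3.20): [picture b]
= [picture b with the vertex label +α and the leg label −(1+α)] + [a local two-scalar-leg vertex with one leg differentiated] (3.22) The
first graph on the right side has positive degree, the second is treated in the same way as the expression (3.15): we sum over proper
orderings and j-indices and we get Σ_{μ=1}^d Σ_x η^dφ(x)·[q²Σ_{x′}η^d(∂^η_μG^η_{j″}(0))(x,x′)g(x)G^η_{j″}(x,x′)g′(x′)](∂^η_μφ′)(x). (3.23)"*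

READING OF THE PICTURES (the only non-verbatim step; it is forced by (3.23), whose bracket is r15's `bracket323`).  Graph (b): the
vertex at `x` is (1.8)_{1,0} with the external leg `φ(x)` undifferentiated and the covariant derivative on the internal scalar line —
kernel `(∂^η_μG_{(j)}(0))(x,x′)` = `d1Kernel η⁻¹ μ G_{(j)}(0)` —, the vertex at `x′` is (1.8)_{1,0} with the derivative on the EXTERNAL leg
`(∂^η_μφ′)(x′)`; the vector line `G_{(j′)}(x,x′)δ_{μν}` identifies the two bond directions; localization functions `g(x)`, `g′(x′)`; the
charge matrices act as `φ(x)·q(…)q(∂^η_μφ′)(x′)` exactly as in (3.9)/(3.23); couplings extracted (p. 433).  So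
`expr321b = Σ_μΣ_{x,x′}η^{2d}(∂^η_μG_{(j)}(0))(x,x′)g(x)G_{(j′)}(x,x′)g′(x′)·φ(x)·q²(∂^η_μφ′)(x′)`, and (3.22) is the ZERO-ORDER Taylor
formula for the differentiated leg, `(∂^η_μφ′)(x′) = (∂^η_μφ′)(x) + [(∂^η_μφ′)(x′) − (∂^η_μφ′)(x)]` (the step of (3.19)/(3.20)): the local
term IS r15's `expr323 η q G_{(j)}(0) G_{(j′)} g g′ φ φ′` (the pre-resummation (3.23)), the difference term is the generalized graph
*"+α … −(1+α)"* (`rem322`; with `|x−x′|^α` inserted and divided as print does in (3.19): `holder322`, `rem322_eq_holder322`).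
Graph (a): the (1.8)_{2,0} vertex (p. 413: `½η·Σ_bη^d[(D^η φ′)(b)·q²φ′(b_−)](A′_b)²`, couplings extracted) with its two vector legs
contracted into the loop `G_{(j)}(b,b)`: `expr321a = Σ_μΣ_xη^d·(ηG(x,x))·g(x)·φ(x)·q²(∂^η_μφ′)(x)` — a LOCAL vertex whose function is
`ηG(x,x)g(x)` (the factor ½ and the couplings are constants outside the expression).

WHAT IS PROVED, and how.
* §1 the expressions: `expr321a`, `ker321` (the kernel of graph (b) = the integrand of `bracket323`, `bracket323_eq`), `expr321b`,
  `rem322`, `holder322`; **`eq322`**: `expr321b = rem322 + expr323` (every `η`, all kernels, all fields — an algebraic identity);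
  `rem322_eq_holder322` (the inserted-and-divided form, any `dist` positive off the diagonal, any `α`); `abs_expr321a_le`: graph (a)
  is a local vertex with coefficient `sup|ηG(x,x)g(x)|`.
* §2 the chain (3.22) → (3.23): multilinearity of `expr321a`, `ker321`, `expr321b`, `rem322` in the line kernels (`…_finset_sum`,
  `…_sum_sum`), **`sum_expr321b_eq`** (`Σ_{j,j′<j″}expr321b[G_{(j)}(0),G_{(j′)}] = Σ_{j,j′<j″}rem322[j,j′] + expr323[Σ_jG_{(j)}(0), Σ_{j′}G_{(j′)}]`)
  and, with (2.6) `B3.Display26` for both lines, **`sum_expr321b_eq_of_display26`** (`… + expr323[G_{j″}(0), G_{j″}]` = (3.23)).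
HONEST SCOPE: everything here holds for every `d`, every `η`, all kernels, localizations and fields (identities and multilinearity); the
summation *"over proper orderings and j-indices"* is taken literally over `[0,j″)²` (the admissibility bookkeeping of row B3.Eq2.7 is not
re-derived, as in `B3Resummation315`); the LIMIT `ηG_k(x,x) → const` (`η → 0`) is not claimed (row cells: p20 g4 `B3CxiTadpoleLimit`,
boundedness p39 g6 `B3GkZeroTorusRescaled.eta_mul_abs_G0xi_diag_le`, used in the companion file); the parallel transports `U(B̃(Γ))` of
the legs are not carried (the torus calculus of record has `pdiff` = the plain forward difference, as in (3.9)/(3.23) of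
`B3Sect3ScalarSelfEnergy`; p. 433 gauges `B̃₀` away).  D-0026: definitions with bodies + theorems only, no named facts, no `sorry`;
standard axioms.  Unit `lit-balaban-p18-g8` (literature-prover-lit-balaban-p18-g8-0), HOME `run/shared/lean/pub/lit-balaban/`, 2026-08-21.
-/

open scoped BigOperators RealInnerProductSpace

namespace Literature.MathematicalPhysics.QuantumFieldTheory.Balaban1983to89.B3Eq322OneLegDifferentiated

open Finset LatticeFieldCalculus B3Sect3ScalarSelfEnergy B3Resummation315

noncomputable section

/-! ## §1 The expressions of the two graphs of (3.21) and the identity (3.22) -/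

section Expr321

variable {P : Params} {j : ℕ} {W : Type*} [NormedAddCommGroup W] [InnerProductSpace ℝ W]

/-- **(3.21) p. 438 [PDF 28], the FIRST graph** (one vertex, two external scalar legs one of which is differentiated, a vector-field
loop): the (1.8)_{2,0} vertex `½η·Σ_bη^d[(D^η_{B̃}φ′)(b)·q²φ′(b_−)](A′_b)²` (p. 413) with its two vector legs contracted into `G(b,b)`,
couplings and the factor ½ extracted: `Σ_μΣ_xη^d·(ηG(x,x))·g(x)·φ(x)·q²(∂^η_μφ′)(x)` — a local vertex with the function `ηG(x,x)`
(*"The expression corresponding to the first graph is in fact convergent, because ηG_k(x,x) is convergent to some finite constant as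
η → 0"*), `g` the localization function, `G` the vector-field propagator as a two-point kernel (internal-index structure = identity,
as in `B3Sect3ScalarSelfEnergy`). [cite: Balaban1983Higgs3, (3.21) p.438] -/
def expr321a (η : ℝ) (q : W →ₗ[ℝ] W) (G : Kernel P j) (g : SiteField P j ℝ) (φ φ' : SiteField P j W) : ℝ :=
  ∑ μ : Fin P.d, ∑ x : Site P j, η ^ P.d * (η * G x x * g x * ⟪φ x, q (q (pdiff η⁻¹ μ φ' x))⟫)

/-- **(3.21) p. 438, the SECOND graph, its two-point kernel** without the charge matrices: `k_μ(x,x′) = (∂^η_μG_{(j)}(0))(x,x′)g(x)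
G_{(j′)}(x,x′)g′(x′)` — the scalar line `G_{(j)}(0)` differentiated at the vertex `x` (r15's `d1Kernel`), the vector line `G_{(j′)}`, the
localization functions; it is the integrand of the square bracket of (3.23) (`bracket323_eq`). [cite: Balaban1983Higgs3, (3.21) p.438] -/
def ker321 (η : ℝ) (μ : Fin P.d) (G0 Gj : Kernel P j) (g g' : SiteField P j ℝ) : Kernel P j :=
  fun x x' => d1Kernel η⁻¹ μ G0 x x' * g x * Gj x x' * g' x'

/-- kernel: the square bracket of (3.23) without `q²` is the `x′`-integral of the kernel of the second graph of (3.21):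
`[bracket (3.23)](x) = Σ_{x′}η^d k_μ(x,x′)`. [cite: Balaban1983Higgs3, (3.23) p.439] -/
theorem bracket323_eq (η : ℝ) (μ : Fin P.d) (G0 Gj : Kernel P j) (g g' : SiteField P j ℝ) (x : Site P j) :
    bracket323 η μ G0 Gj g g' x = ∑ x' : Site P j, η ^ P.d * ker321 η μ G0 Gj g g' x x' := rfl

/-- **(3.21) p. 438 [PDF 28], the SECOND graph** (vertices `x`, `x′` joined by the scalar line `G_{(j)}(0)` — differentiated at `x` —
and the vector line `G_{(j′)}`; the external leg `φ` at `x`, the DIFFERENTIATED external leg `∂^η_μφ′` at `x′`), read off the picture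
consistently with (3.23): `Σ_μΣ_{x,x′}η^{2d}(∂^η_μG_{(j)}(0))(x,x′)g(x)G_{(j′)}(x,x′)g′(x′)·φ(x)·q²(∂^η_μφ′)(x′)`.
[cite: Balaban1983Higgs3, (3.21) p.438] -/
def expr321b (η : ℝ) (q : W →ₗ[ℝ] W) (G0 Gj : Kernel P j) (g g' : SiteField P j ℝ) (φ φ' : SiteField P j W) : ℝ :=
  ∑ μ : Fin P.d, ∑ x : Site P j, ∑ x' : Site P j,
    η ^ (2 * P.d) * (ker321 η μ G0 Gj g g' x x' * ⟪φ x, q (q (pdiff η⁻¹ μ φ' x'))⟫)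

/-- **(3.22) p. 439 [PDF 29], the FIRST graph of the right side** (vertex label `+α`, leg label `−(1+α)`), in plain form: the kernel
of the second graph of (3.21) paired with the DIFFERENCE `(∂^η_μφ′)(x′) − (∂^η_μφ′)(x)` of the differentiated leg — a differentiation of
the order `1 + α` once the Hölder quotient is exhibited (`holder322`, `rem322_eq_holder322`). [cite: Balaban1983Higgs3, (3.22) p.439] -/
def rem322 (η : ℝ) (q : W →ₗ[ℝ] W) (G0 Gj : Kernel P j) (g g' : SiteField P j ℝ) (φ φ' : SiteField P j W) : ℝ :=
  ∑ μ : Fin P.d, ∑ x : Site P j, ∑ x' : Site P j,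
    η ^ (2 * P.d) * (ker321 η μ G0 Gj g g' x x' * ⟪φ x, q (q (pdiff η⁻¹ μ φ' x' - pdiff η⁻¹ μ φ' x))⟫)

/-- **(3.22) p. 439, the first graph of the right side in the printed form of (3.19)/(3.20)**: the kernel gains the weight `|x−x′|^α`
(*"+α"*), the leg becomes the Hölder quotient of its derivative `((∂^η_μφ′)(x′) − (∂^η_μφ′)(x))/|x−x′|^α` (*"−(1+α)"*); `dist` = the
distance `|x−x′|` (any function positive off the diagonal). [cite: Balaban1983Higgs3, (3.22) p.439] -/
def holder322 (η α : ℝ) (dist : Site P j → Site P j → ℝ) (q : W →ₗ[ℝ] W) (G0 Gj : Kernel P j) (g g' : SiteField P j ℝ)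
    (φ φ' : SiteField P j W) : ℝ :=
  ∑ μ : Fin P.d, ∑ x : Site P j, ∑ x' : Site P j,
    η ^ (2 * P.d) * ((ker321 η μ G0 Gj g g' x x' * dist x x' ^ α) *
      ⟪φ x, q (q ((dist x x' ^ α)⁻¹ • (pdiff η⁻¹ μ φ' x' - pdiff η⁻¹ μ φ' x)))⟫)

/-- **(3.22)** p. 439 [PDF 29], verbatim: *"The second expression is transformed in a way similar to (3.17) and (3.20): [second graph
of (3.21)] = [the same graph with labels +α, −(1+α)] + [local vertex] (3.22) … the second is treated in the same way as the expression
(3.15)"* — PROVED as the identity it is (the zero-order Taylor formula for the differentiated leg, `(∂^η_μφ′)(x′) = (∂^η_μφ′)(x) +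
[(∂^η_μφ′)(x′) − (∂^η_μφ′)(x)]`, by bilinearity of the pairing): for every `η`, all line kernels, localizations and fields,
`expr321b = rem322 + expr323`, the local term being r15's (3.23)-expression on the SAME kernels `G_{(j)}(0)`, `G_{(j′)}` (before the
summation over orderings and indices). [cite: Balaban1983Higgs3, (3.22) p.439] -/
theorem eq322 (η : ℝ) (q : W →ₗ[ℝ] W) (G0 Gj : Kernel P j) (g g' : SiteField P j ℝ) (φ φ' : SiteField P j W) :
    expr321b η q G0 Gj g g' φ φ' = rem322 η q G0 Gj g g' φ φ' + expr323 η q G0 Gj g g' φ φ' := by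
  have h2d : η ^ (2 * P.d) = η ^ P.d * η ^ P.d := by rw [two_mul, pow_add]
  unfold expr321b rem322 expr323
  rw [← Finset.sum_add_distrib]
  refine Finset.sum_congr rfl fun μ _ => ?_
  rw [← Finset.sum_add_distrib]
  refine Finset.sum_congr rfl fun x _ => ?_
  rw [bracket323_eq, Finset.sum_mul, Finset.mul_sum, ← Finset.sum_add_distrib]
  refine Finset.sum_congr rfl fun x' _ => ?_
  rw [map_sub, map_sub, inner_sub_right, h2d]
  ring

/-- **(3.22), the first graph of the right side in the printed (3.19)-form**: for every exponent `α` and every `dist` positive off the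
diagonal, `rem322 = holder322` (the `x′ = x` terms vanish on both sides; off the diagonal `|x−x′|^α·|x−x′|^{−α} = 1`).
[cite: Balaban1983Higgs3, (3.22) p.439] -/
theorem rem322_eq_holder322 (η α : ℝ) (dist : Site P j → Site P j → ℝ) (hpos : ∀ x x' : Site P j, x ≠ x' → 0 < dist x x')
    (q : W →ₗ[ℝ] W) (G0 Gj : Kernel P j) (g g' : SiteField P j ℝ) (φ φ' : SiteField P j W) :
    rem322 η q G0 Gj g g' φ φ' = holder322 η α dist q G0 Gj g g' φ φ' := by
  unfold rem322 holder322
  refine Finset.sum_congr rfl fun μ _ => Finset.sum_congr rfl fun x _ => Finset.sum_congr rfl fun x' _ => ?_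
  congr 1
  by_cases hx : x = x'
  · subst hx
    simp
  · have hd : dist x x' ^ α ≠ 0 := (Real.rpow_pos_of_pos (hpos x x' hx) α).ne'
    rw [map_smul, map_smul, real_inner_smul_right, mul_assoc (ker321 η μ G0 Gj g g' x x'),
      ← mul_assoc (dist x x' ^ α), mul_inv_cancel₀ hd, one_mul]

/-- **(3.21), the first graph is a LOCAL vertex with the function `ηG(x,x)g(x)`**: if `|ηG(x,x)g(x)| ≤ B` for all `x`, then
`|expr321a| ≤ B·Σ_μΣ_xη^d‖φ(x)‖‖q²(∂^η_μφ′)(x)‖` (`η ≥ 0`) — the shape of *"a vertex with some convergent function"*; the bound `B`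
is supplied at the torus instance by `expr321a_zero_torus`. [cite: Balaban1983Higgs3, (3.21) p.438] -/
theorem abs_expr321a_le {η B : ℝ} (hη : 0 ≤ η) (q : W →ₗ[ℝ] W) (G : Kernel P j) (g : SiteField P j ℝ)
    (hB : ∀ x : Site P j, |η * G x x * g x| ≤ B) (φ φ' : SiteField P j W) :
    |expr321a η q G g φ φ'| ≤ B * ∑ μ : Fin P.d, ∑ x : Site P j, η ^ P.d * (‖φ x‖ * ‖q (q (pdiff η⁻¹ μ φ' x))‖) := by
  unfold expr321a
  rw [Finset.mul_sum]
  refine (Finset.abs_sum_le_sum_abs _ _).trans (Finset.sum_le_sum fun μ _ => ?_)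
  rw [Finset.mul_sum]
  refine (Finset.abs_sum_le_sum_abs _ _).trans (Finset.sum_le_sum fun x _ => ?_)
  rw [abs_mul, abs_of_nonneg (by positivity : (0 : ℝ) ≤ η ^ P.d), abs_mul]
  have hi : |⟪φ x, q (q (pdiff η⁻¹ μ φ' x))⟫| ≤ ‖φ x‖ * ‖q (q (pdiff η⁻¹ μ φ' x))‖ := abs_real_inner_le_norm _ _
  have hB0 : 0 ≤ B := (abs_nonneg _).trans (hB x)
  calc η ^ P.d * (|η * G x x * g x| * |⟪φ x, q (q (pdiff η⁻¹ μ φ' x))⟫|)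
      ≤ η ^ P.d * (B * (‖φ x‖ * ‖q (q (pdiff η⁻¹ μ φ' x))‖)) :=
        mul_le_mul_of_nonneg_left (mul_le_mul (hB x) hi (abs_nonneg _) hB0) (by positivity)
    _ = B * (η ^ P.d * (‖φ x‖ * ‖q (q (pdiff η⁻¹ μ φ' x))‖)) := by ring

end Expr321

/-! ## §2 The chain (3.22) → (3.23): "we sum over proper orderings and j-indices" -/

section Resum

variable {P : Params} {j : ℕ} {ι κ : Type*} (s : Finset ι) (t : Finset κ)
variable {W : Type*} [NormedAddCommGroup W] [InnerProductSpace ℝ W]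

/-- kernel: a finite sum of two-point kernels evaluated at a pair of sites. [folklore] -/
private theorem sum_kernel_apply' (G : ι → Kernel P j) (x x' : Site P j) :
    (∑ i ∈ s, G i) x x' = ∑ i ∈ s, (G i) x x' := by
  rw [Finset.sum_apply, Finset.sum_apply]

/-- kernel: a family index pulled out of a double sum over finite types. [folklore] -/
private theorem sum_univ2_rot {α β : Type*} [Fintype α] [Fintype β] (f : α → β → ι → ℝ) :
    ∑ a : α, ∑ b : β, ∑ i ∈ s, f a b i = ∑ i ∈ s, ∑ a : α, ∑ b : β, f a b i := by
  calc ∑ a : α, ∑ b : β, ∑ i ∈ s, f a b i = ∑ a : α, ∑ i ∈ s, ∑ b : β, f a b i :=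
        Finset.sum_congr rfl fun a _ => Finset.sum_comm
    _ = ∑ i ∈ s, ∑ a : α, ∑ b : β, f a b i := Finset.sum_comm

/-- kernel: two family indices pulled out of a sum over a finite type. [folklore] -/
private theorem sum_univ_rot2 {α : Type*} [Fintype α] (f : α → ι → κ → ℝ) :
    ∑ a : α, ∑ i ∈ s, ∑ i' ∈ t, f a i i' = ∑ i ∈ s, ∑ i' ∈ t, ∑ a : α, f a i i' := by
  calc ∑ a : α, ∑ i ∈ s, ∑ i' ∈ t, f a i i' = ∑ i ∈ s, ∑ a : α, ∑ i' ∈ t, f a i i' := Finset.sum_comm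
    _ = ∑ i ∈ s, ∑ i' ∈ t, ∑ a : α, f a i i' := Finset.sum_congr rfl fun i _ => Finset.sum_comm

/-- kernel: two family indices pulled out of a triple sum over finite types. [folklore] -/
private theorem sum_univ3_rot2 {α β γ : Type*} [Fintype α] [Fintype β] [Fintype γ] (f : α → β → γ → ι → κ → ℝ) :
    ∑ a : α, ∑ b : β, ∑ c : γ, ∑ i ∈ s, ∑ i' ∈ t, f a b c i i' =
      ∑ i ∈ s, ∑ i' ∈ t, ∑ a : α, ∑ b : β, ∑ c : γ, f a b c i i' := by
  calc ∑ a : α, ∑ b : β, ∑ c : γ, ∑ i ∈ s, ∑ i' ∈ t, f a b c i i'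
      = ∑ a : α, ∑ b : β, ∑ i ∈ s, ∑ i' ∈ t, ∑ c : γ, f a b c i i' :=
        Finset.sum_congr rfl fun a _ => Finset.sum_congr rfl fun b _ => sum_univ_rot2 s t (f a b)
    _ = ∑ a : α, ∑ i ∈ s, ∑ i' ∈ t, ∑ b : β, ∑ c : γ, f a b c i i' :=
        Finset.sum_congr rfl fun a _ => sum_univ_rot2 s t fun b i i' => ∑ c : γ, f a b c i i'
    _ = ∑ i ∈ s, ∑ i' ∈ t, ∑ a : α, ∑ b : β, ∑ c : γ, f a b c i i' :=
        sum_univ_rot2 s t fun a i i' => ∑ b : β, ∑ c : γ, f a b c i i'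

/-- The first graph of (3.21) is LINEAR in its loop propagator: on `G = Σ_iG_{(i)}` it is the sum of the expressions on the pieces
(the summation over the index of its one internal line). [cite: Balaban1983Higgs3, (3.21) p.438] -/
theorem expr321a_finset_sum (η : ℝ) (q : W →ₗ[ℝ] W) (G : ι → Kernel P j) (g : SiteField P j ℝ) (φ φ' : SiteField P j W) :
    expr321a η q (∑ i ∈ s, G i) g φ φ' = ∑ i ∈ s, expr321a η q (G i) g φ φ' := by
  unfold expr321a
  simp only [sum_kernel_apply', Finset.mul_sum, Finset.sum_mul]
  exact sum_univ2_rot s _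

/-- The kernel of the second graph of (3.21) is BILINEAR in its two line propagators: for `G₀ = Σ_iG₀ᵢ`, `G = Σ_{i′}G_{i′}`,
`k[G₀,G](x,x′) = Σ_iΣ_{i′}k[G₀ᵢ,G_{i′}](x,x′)`. [cite: Balaban1983Higgs3, (3.22)–(3.23) p.439] -/
theorem ker321_sum_sum (η : ℝ) (μ : Fin P.d) (G0 : ι → Kernel P j) (G : κ → Kernel P j) (g g' : SiteField P j ℝ)
    (x x' : Site P j) :
    ker321 η μ (∑ i ∈ s, G0 i) (∑ i' ∈ t, G i') g g' x x' = ∑ i ∈ s, ∑ i' ∈ t, ker321 η μ (G0 i) (G i') g g' x x' := by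
  simp only [ker321, d1Kernel_finset_sum, sum_kernel_apply']
  rw [Finset.sum_mul, Finset.sum_mul, Finset.sum_mul]
  refine Finset.sum_congr rfl fun i _ => ?_
  rw [Finset.mul_sum, Finset.sum_mul]

/-- The second graph of (3.21) is BILINEAR in its two line propagators (*"we sum over proper orderings and j-indices"*: the double
sum over the indices of the two internal lines of the expressions on the pieces is the expression on the summed propagators).
[cite: Balaban1983Higgs3, (3.22)–(3.23) p.439] -/
theorem expr321b_sum_sum (η : ℝ) (q : W →ₗ[ℝ] W) (G0 : ι → Kernel P j) (G : κ → Kernel P j) (g g' : SiteField P j ℝ)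
    (φ φ' : SiteField P j W) :
    expr321b η q (∑ i ∈ s, G0 i) (∑ i' ∈ t, G i') g g' φ φ' =
      ∑ i ∈ s, ∑ i' ∈ t, expr321b η q (G0 i) (G i') g g' φ φ' := by
  unfold expr321b
  simp only [ker321_sum_sum, Finset.sum_mul, Finset.mul_sum]
  -- move the two family indices `i, i′` outermost
  exact sum_univ3_rot2 s t _

/-- The first graph of the right side of (3.22) is BILINEAR in its two line propagators (from `eq322` and the bilinearity of both
other members). [cite: Balaban1983Higgs3, (3.22)–(3.23) p.439] -/
theorem rem322_sum_sum (η : ℝ) (q : W →ₗ[ℝ] W) (G0 : ι → Kernel P j) (G : κ → Kernel P j) (g g' : SiteField P j ℝ)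
    (φ φ' : SiteField P j W) :
    rem322 η q (∑ i ∈ s, G0 i) (∑ i' ∈ t, G i') g g' φ φ' =
      ∑ i ∈ s, ∑ i' ∈ t, rem322 η q (G0 i) (G i') g g' φ φ' := by
  have h := eq322 η q (∑ i ∈ s, G0 i) (∑ i' ∈ t, G i') g g' φ φ'
  rw [expr321b_sum_sum, ← expr323_sum_sum s t η q G0 G g g' φ φ'] at h
  have h' : ∑ i ∈ s, ∑ i' ∈ t, expr321b η q (G0 i) (G i') g g' φ φ' =
      (∑ i ∈ s, ∑ i' ∈ t, rem322 η q (G0 i) (G i') g g' φ φ') +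
        ∑ i ∈ s, ∑ i' ∈ t, expr323 η q (G0 i) (G i') g g' φ φ' := by
    rw [← Finset.sum_add_distrib]
    refine Finset.sum_congr rfl fun i _ => ?_
    rw [← Finset.sum_add_distrib]
    exact Finset.sum_congr rfl fun i' _ => eq322 η q (G0 i) (G i') g g' φ φ'
  linarith

/-- **(3.22) then (3.23), p. 439** — *"the second is treated in the same way as the expression (3.15): we sum over proper orderings and
j-indices and we get (3.23)"*: for every `η`, every scale `k = j″` and all kernel families, the expressions of the second graph of
(3.21) with lines `G_{(i)}(0)`, `G_{(i′)}` summed over `i, i′ < k` EQUAL the sum of the generalized graphs `rem322[i,i′]` plus the local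
vertex (3.23) built on the resummed propagators `Σ_{i<k}G_{(i)}(0)`, `Σ_{i′<k}G_{(i′)}` ((3.22) for each pair and p20's
`expr323_sum_sum`). [cite: Balaban1983Higgs3, (3.22)–(3.23) p.439] -/
theorem sum_expr321b_eq (η : ℝ) (q : W →ₗ[ℝ] W) (k : ℕ) (G0fam Gfam : ℕ → Kernel P j) (g g' : SiteField P j ℝ)
    (φ φ' : SiteField P j W) :
    ∑ i ∈ range k, ∑ i' ∈ range k, expr321b η q (G0fam i) (Gfam i') g g' φ φ' =
      (∑ i ∈ range k, ∑ i' ∈ range k, rem322 η q (G0fam i) (Gfam i') g g' φ φ') +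
        expr323 η q (∑ i ∈ range k, G0fam i) (∑ i' ∈ range k, Gfam i') g g' φ φ' := by
  rw [← expr323_sum_sum (range k) (range k) η q G0fam Gfam g g' φ φ', ← Finset.sum_add_distrib]
  refine Finset.sum_congr rfl fun i _ => ?_
  rw [← Finset.sum_add_distrib]
  exact Finset.sum_congr rfl fun i' _ => eq322 η q (G0fam i) (Gfam i') g g' φ φ'

/-- **(3.22) → (3.23) with the multiscale decomposition (2.6)**: if `G^η_{j″}(0) = Σ_{i<j″}G^η_{(i)}(0)` and `G^η_{j″} = Σ_{i′<j″}G^η_{(i′)}`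
(r15's `B3.Display26` for the two lines), the summed second graph of (3.21) is `Σ_{i,i′<j″}rem322[i,i′]` plus EXACTLY the printed
(3.23) `expr323 η q G^η_{j″}(0) G^η_{j″}`. [cite: Balaban1983Higgs3, (3.22)–(3.23) p.439] -/
theorem sum_expr321b_eq_of_display26 (η : ℝ) (q : W →ₗ[ℝ] W) {j'' : ℕ} {G0 G : Kernel P j} {G0fam Gfam : ℕ → Kernel P j}
    (h0 : B3.Display26 G0 G0fam j'') (h : B3.Display26 G Gfam j'') (g g' : SiteField P j ℝ) (φ φ' : SiteField P j W) :
    ∑ i ∈ range j'', ∑ i' ∈ range j'', expr321b η q (G0fam i) (Gfam i') g g' φ φ' =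
      (∑ i ∈ range j'', ∑ i' ∈ range j'', rem322 η q (G0fam i) (Gfam i') g g' φ φ') +
        expr323 η q G0 G g g' φ φ' := by
  rw [sum_expr321b_eq, ← expr323_resum η q h0 h g g' φ φ', expr323_sum_sum]

end Resum

end

end Literature.MathematicalPhysics.QuantumFieldTheory.Balaban1983to89.B3Eq322OneLegDifferentiated
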